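import Summits.QuantumFields.YangMills.Theorems.UnitScaleTiltCoverFlatHKey
import Summits.QuantumFields.YangMills.Theorems.UnitScaleTiltCoverLettersDcsE
import Summits.QuantumFields.YangMills.Theorems.UnitScaleTiltProp8FlatPortBodyL0
import Summits.QuantumFields.YangMills.Theorems.UnitScaleTiltProp8FlatPortGBandL0
import Summits.QuantumFields.YangMills.Theorems.UnitScaleTiltProp8FlatPortCurlCurlSupRowL0
import Summits.QuantumFields.YangMills.Theorems.UnitScaleTiltProp8FlatPortCurlCurlSupRowSharpL0
import Summits.QuantumFields.YangMills.Theorems.UnitScaleTiltProp8FlatPortRechart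
import HarnessLib

/-!
# Route `UnitScaleTilt`, crux K1 child «MinimiserStabilityRegPr» (stmt-QuantumFields-19200), registered stub `stub_halvingStep` (H), branch **(P2-small)**,
# mechanism of record **(α) COVERING ∕ PERIODISATION** (OWNER RULING g26-№18, ACK 31 (2), ACK 36 ROW 2, ACK 38) — file **α6a `FlatPortAllSizes`**:
# **THE P2 PORTS AT EVERY TORUS SIZE — the binder `a′ + 3 ≤ m + n` of ✓`FlatPortBodyL0.body_of_adm22` (P-1), ✓`FlatPortGBandL0.gBand_of_adm22` (P-2),
# ✓`FlatPortCurlCurlSupRowL0.curlCurlSupRow_of_adm22` (P-3) and ✓`…SharpL0.curlCurlSupRowSharp_of_adm22` (P-3♯) DELETED**, plus (P-1′) the (46) sup row of the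
# canonical `flatH` at every size (the one row of ✓`rowsAt_of_adm22` its three consumers read).

THE MECHANISM (uniform — no case split on the torus size).  A member `F = ⟨L, m⟩` whose torus is too small for the chart of the ✓L0 ports (`a′ + 3 > m + n`) is
read on its `L^{jc}`-fold cover `F.cover jc` (✓`CoverSites`), `jc := M_h⁰ + 2` FIXED: (i) the big-block exponent is first REDUCED to `a″ := min a′ M_h⁰` (`liftData`:
`M_h″ := L^{a″} ≥ M_h⁰` by `Nat.lt_pow_self`, `L·M_h″ ∣ L·M_h` so `Adm22 D R (L·M_h″)` by ✓`FlatPortRechart.adm22_of_dvd`, lifted to `Adm22 (D.comap jc) R (L·M_h″)` by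
✓`CoverDomains.adm22_comap`), whence `a″ + 3 ≤ (m + jc) + n` ALWAYS; (ii) the ✓L0 port is applied UPSTAIRS at the member `m + jc` (`(F.cover jc).P K = PV 2 ℓ (m+jc) K …` and
`D.comap jc : Domains (PV 2 ℓ (m+jc) K …)` hold by `rfl`) with the lifted level weights `w ∘ projBond` (✓`isLevWeight_comap`); (iii) the letters DESCEND by the
T³-generic lemmas of §1 — `body_of_cover` (✓`CoverLetters.lettersMS_of_cover'` with `H := flatH D`, `G̃ := gtOf (GE, a ≡ 1)`, `hH := isFlatH_cover`, `hGt := isFlatGt_cover`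
of ★★★✓`CoverFlatHKey`; constant `B₀·(L^{jc})³`), `hSupFlatH_of_cover` (SAME constant, ★★★`flatH_cover`), `gBand_of_cover` (SAME `C_G`: downstairs `G :=` the genuine
`GE_D` at the UNIT-BAND weights `w♯(c) = (L^{K−n}/L^{j(c)})²(L^{j(c)})³`, `w♯ ∘ projIdx ≡ w̃♯` because `projIdx` keeps the level by `rfl`; ✓`isFlatGW_cover` +
✓`gtSupLetterG_of_cover`), `curlCurlSup_of_cover`∕`curlCurlSupSharp_of_cover` (SAME `C_X`: ★★★`flatH_cover` + ✓`CoverLettersDcsE.dcsE_dcE_cover` at a lift of the bond).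
The one interface that had to be OPENED is (P-2)'s `∃ w′`: §2 re-runs the 45-line proof of ✓`gBand_domT` with the unit-band weights DISPLAYED (`gBandU_domT`,
`gBandU_of_adm22`) — `isFlatGW_cover` needs the cover's weights to be `w′ ∘ projIdx`.

Cell `ym3-torus` (HUMAN RULING D-0037, YM ladder rung R3 — continuum SU(2) YM₃ on the torus is a RUNG, not the Clay problem), explicit-unit helper seat
`ym-ust-19200-w7` gen 0.  `--supports stmt-QuantumFields-19200 --as helper`; count-neutral; def-free, 0 sorry, standard axioms.

WHAT IS PROVED.  §1 generic descents `exists_isFlatGW`, `exists_isFlatGt`, `body_of_cover`, `hSupFlatH_of_cover`, `gBand_of_cover`, `curlCurlSup_of_cover`,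
`curlCurlSupSharp_of_cover`; §2 `liftData` (size bookkeeping), `gBandU_domT`, `gBandU_of_adm22`; §3 ★(P-1) `body_of_adm22_allSizes`, ★(P-1′) `hSupFlatH_of_adm22_allSizes`,
★(P-2) `gBand_of_adm22_allSizes`, ★(P-3) `curlCurlSupRow_of_adm22_allSizes`, ★(P-3♯) `curlCurlSupRowSharp_of_adm22_allSizes` — each the ✓L0 statement VERBATIM with the
single binder `(_ : a′ + 3 ≤ m + n)` deleted (constants may differ).  HONEST SCOPE: bookkeeping over landed bricks (α1–α5, the key lemma, the L0 ports); the H stub, the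
crux, the rung and the mass gap are NOT touched; (P2-L3) `L = 3` is a separate, Literature-side debt (WANTED №g26-4).

References: T. Bałaban, CMP **102** (1985) 277–309 [Balaban1985Variational] (45)–(46) p.285, (143)–(144) p.300, (157)–(158) p.302, (161)–(163) p.303, (165) p.304;
CMP **96** (1984) 223–250 [Balaban1984PropagatorsII] (2.1)–(2.3) p.224, (2.16) p.225, (2.35) p.228, Prop. 2.6 (2.136) p.247, Prop. 2.7 (2.149) p.249, Cor. 2.8 (2.150)–(2.151)
p.249; CMP **95** (1984) 17–40 [Balaban1984PropagatorsI] (1.18), (1.20) p.20.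
-/

set_option autoImplicit false

noncomputable section

open scoped BigOperators

namespace Summit.QuantumFields.YangMills.Theorems.FlatPortAllSizes

open Literature.MathematicalPhysics.QuantumFieldTheory.Balaban1983to89
open B6MultiLevelBoxOperator (N0)
open B6MultiLevelTorusOperatorL0 (TDomains)
open B6Geom246MultiLevelTorusL0 (lemma21_torus)
open B6GlobalChartV1 (PV)
open B6GlobalChartV1L0 (domT)
open B6RandomWalk (delta3 delta3_pos)
open B6Ineq261LevelGap (K261 K261_nonneg)
open B6CubeWindowV1 (GlobalBand)
open B6SectADomainsV1 (Domains)
open B6SectAOperatorsV1 (BondIdx dcE dcsE)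
open B6SectAVectorModelV1 (GE)
open B6Prop26LapKLevelV1L0 (prop26_2136_lap_kLevel_unconditional_pad_V1)
open T3ContinuumYM3Torus (T3Family)
open FlatCubeOpsText (Adm22 IsLevWeight distBI IsFlatH IsFlatGt HSupLetterG GtSupLetterG GtLaplaceLetterG HDecayLetterD RowSum162)
open FlatOpsLettersAssembly (flatH IsFlatGW gtOf isFlatH_flatH isFlatGt_gtOf hSupLetterG_mono gtSupLetterG_mono gtLaplaceLetterG_mono hDecayLetterD_mono)
open FlatPortKernelRows (theta_budget absorb_budget chart_params)
open FlatPortKernelRowsL0 (globalBand_unitWeights unitWeights_pos)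
open FlatPortHRows12 (cf_ne_zero)
open FlatPortGRowsL0 (gRows_of_portShapes)
open FlatPortBodyL0 (body_of_adm22 rowsAt_of_adm22)
open FlatPortCurlCurlSupRowL0 (curlCurlSupRow_of_adm22)
open FlatPortCurlCurlSupRowSharpL0 (curlCurlSupRowSharp_of_adm22)
open FlatPortRechart (adm22_of_dvd)
open CoverSites (cover proj projBond)
open CoverDomains (projIdx adm22_comap isLevWeight_comap)
open CoverLetters (liftBond projBond_liftBond hSupLetterG_of_cover gtSupLetterG_of_cover lettersMS_of_cover' dcsE_dcE_cover)
open CoverFlatH (flatH_cover isFlatH_cover isFlatGt_cover isFlatGW_cover)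

/-- `1 ≤ 3` (named once). [folklore] -/
private theorem hd3 : 1 ≤ 2 + 1 := by norm_num

/-! ## §1 The T³-generic descents: the letters of a member from those of its cover -/

section Generic

variable (F : T3Family) (n K jc : ℕ) (D : Domains (F.P K))

/-- **THE GENUINE PROPAGATOR `G = Δ_a⁻¹ = GE_D` WITH ANY POSITIVE WEIGHTS, AS A PLAIN-FUNCTION OPERATOR** (pinned by `IsFlatGW`, by `rfl`).
[cite: Balaban1984PropagatorsII, (2.16) p.225, (2.22) p.226] -/
theorem exists_isFlatGW {w' : BondIdx D → ℝ} (hw' : ∀ i, 0 < w' i) :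
    ∃ G : (PBond (F.P K) 0 → ℝ) →ₗ[ℝ] (PBond (F.P K) 0 → ℝ), IsFlatGW F n K D hw' G :=
  ⟨(WithLp.linearEquiv 2 ℝ (PBond (F.P K) 0 → ℝ)).toLinearMap ∘ₗ
      GE D (c := (F.L : ℝ) ^ (K - n)) (pow_ne_zero _ (Nat.cast_ne_zero.2 (F.P K).L_pos.ne')) (w := w') hw' ∘ₗ
      (WithLp.linearEquiv 2 ℝ (PBond (F.P K) 0 → ℝ)).symm.toLinearMap,
    fun _ _ => rfl⟩

/-- **THE PINNED `G̃ = G − HQG` EXISTS AS A PLAIN-FUNCTION OPERATOR** (`gtOf` of the `a ≡ 1` propagator; canonical). [cite: Balaban1985Variational, (143) p.300, (158) p.302] -/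
theorem exists_isFlatGt : ∃ Gt : (PBond (F.P K) 0 → ℝ) →ₗ[ℝ] (PBond (F.P K) 0 → ℝ), IsFlatGt F n K D Gt := by
  obtain ⟨G, hG⟩ := exists_isFlatGW F n K D (w' := fun _ => (1 : ℝ)) (fun _ => one_pos)
  exact ⟨gtOf F n K D G, isFlatGt_gtOf F n K D _ hG⟩

/-- ★ **(P-1) DESCENDS — THE BODY OF THE P2 TEXT OF A MEMBER FROM THAT OF ITS COVER**: the `body_of_adm22`-shaped conjunction on `(F.cover jc, D.comap jc, w ∘ π)` with
`B₀ ≥ 0`, `δ₀ ≥ 0` gives the same conjunction on `(F, D, w)` with constants `(B₀·(L^{jc})³, δ₀, B₃)` — `H := flatH D`, `G̃ := gtOf (GE, a ≡ 1)`, the periodisation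
identities being ✓`isFlatH_cover`∕`isFlatGt_cover`. [cite: Balaban1985Variational, (46) p.285, (157)-(158) p.302, (161)-(162) p.303, (165) p.304; Balaban1984PropagatorsII, Cor. 2.8 p.249] -/
theorem body_of_cover {w : ℕ → PBond (F.P K) 0 → ℝ} (hw : IsLevWeight F n K D w) {B₀ δ₀ B₃ : ℝ} (hB₀ : 0 ≤ B₀) (hδ₀ : 0 ≤ δ₀)
    (hup : ∃ (Ht : (BondIdx (D.comap jc) → ℝ) →ₗ[ℝ] (PBond ((F.cover jc).P K) 0 → ℝ))
        (Gtt : (PBond ((F.cover jc).P K) 0 → ℝ) →ₗ[ℝ] (PBond ((F.cover jc).P K) 0 → ℝ)),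
        IsFlatH (F.cover jc) n K (D.comap jc) Ht ∧ IsFlatGt (F.cover jc) n K (D.comap jc) Gtt ∧
        HSupLetterG (F.cover jc) n K (D.comap jc) (fun m bt => w m (projBond (F.P K) jc 0 bt)) Ht B₀ ∧
          GtSupLetterG (F.cover jc) n K (fun m bt => w m (projBond (F.P K) jc 0 bt)) Gtt B₀ ∧
          GtLaplaceLetterG (F.cover jc) n K (fun m bt => w m (projBond (F.P K) jc 0 bt)) Gtt B₀ ∧
        ∃ dBIt : PBond ((F.cover jc).P K) 0 → BondIdx (D.comap jc) → ℝ,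
          (∀ b c, distBI (D.comap jc) b c ≤ dBIt b c) ∧ RowSum162 (F.cover jc) n K (D.comap jc) dBIt (fun m bt => w m (projBond (F.P K) jc 0 bt)) δ₀ B₃ ∧
            HDecayLetterD (F.cover jc) n K (D.comap jc) dBIt (fun m bt => w m (projBond (F.P K) jc 0 bt)) Ht B₀ δ₀) :
    ∃ (H : (BondIdx D → ℝ) →ₗ[ℝ] (PBond (F.P K) 0 → ℝ)) (Gt : (PBond (F.P K) 0 → ℝ) →ₗ[ℝ] (PBond (F.P K) 0 → ℝ)),
      IsFlatH F n K D H ∧ IsFlatGt F n K D Gt ∧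
      HSupLetterG F n K D w H (B₀ * ((F.L ^ jc) ^ 3 : ℕ)) ∧ GtSupLetterG F n K w Gt (B₀ * ((F.L ^ jc) ^ 3 : ℕ)) ∧
        GtLaplaceLetterG F n K w Gt (B₀ * ((F.L ^ jc) ^ 3 : ℕ)) ∧
      ∃ dBI : PBond (F.P K) 0 → BondIdx D → ℝ,
        (∀ b c, distBI D b c ≤ dBI b c) ∧ RowSum162 F n K D dBI w δ₀ B₃ ∧ HDecayLetterD F n K D dBI w H (B₀ * ((F.L ^ jc) ^ 3 : ℕ)) δ₀ := by
  classical
  obtain ⟨Ht, Gtt, hFHt, hFGt, h1, h2, h3, dBIt, hdom, h4, h5⟩ := hup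
  obtain ⟨Gt, hFG⟩ := exists_isFlatGt F n K D
  exact ⟨flatH F n K D, Gt, isFlatH_flatH F n K D, hFG,
    lettersMS_of_cover' F n K jc D hw hB₀ hδ₀ (fun X bt => isFlatH_cover F n K jc D (isFlatH_flatH F n K D) hFHt X bt)
      (fun f bt => isFlatGt_cover F n K jc D hFG hFGt f bt) h1 h2 h3 hdom h4 h5⟩

/-- ★ **(P-1′) DESCENDS WITH THE SAME CONSTANT — THE (46) SUP ROW OF THE CANONICAL `flatH`** (★★★`flatH_cover` + ✓`hSupLetterG_of_cover`).
[cite: Balaban1985Variational, (46) p.285, (157) p.302; Balaban1984PropagatorsII, Cor. 2.8 p.249] -/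
theorem hSupFlatH_of_cover {w : ℕ → PBond (F.P K) 0 → ℝ} {C : ℝ}
    (hup : HSupLetterG (F.cover jc) n K (D.comap jc) (fun m bt => w m (projBond (F.P K) jc 0 bt)) (flatH (F.cover jc) n K (D.comap jc)) C) :
    HSupLetterG F n K D w (flatH F n K D) C :=
  hSupLetterG_of_cover F n K jc D (fun X bt => flatH_cover F n K jc D X bt) hup

/-- ★ **(P-2) DESCENDS WITH THE SAME `C_G` — THE `G`-BAND PACKAGE**: from the genuine propagator of the COVER at the unit-band weights `w̃♯(c̃) = (L^{K−n}/L^{j(c̃)})²(L^{j(c̃)})³`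
with `GtSupLetterG … C_G`, the member's `GE_D` at `w♯` (same formula; `w♯ ∘ projIdx ≡ w̃♯` since `projIdx` keeps the level) is pinned, carries `GtSupLetterG … C_G`
(✓`isFlatGW_cover` + ✓`gtSupLetterG_of_cover`) and lies in the band `w♯(c) ≤ (L^{K−n})²L^{j(c)}` (`(a/b)²b³ = a²b`).
[cite: Balaban1984PropagatorsII, (2.16) p.225, (2.22) p.226, Prop. 2.6 (2.136) p.247; Balaban1985Variational, (165) p.304] -/
theorem gBand_of_cover {w : ℕ → PBond (F.P K) 0 → ℝ} {CG : ℝ}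
    (hup : ∃ (hwt : ∀ i : BondIdx (D.comap jc), 0 < ((F.L : ℝ) ^ (K - n) / (F.L : ℝ) ^ (i.1.1 : ℕ)) ^ 2 * ((F.L : ℝ) ^ (i.1.1 : ℕ)) ^ (2 + 1))
        (Gc : (PBond ((F.cover jc).P K) 0 → ℝ) →ₗ[ℝ] (PBond ((F.cover jc).P K) 0 → ℝ)),
        IsFlatGW (F.cover jc) n K (D.comap jc) hwt Gc ∧ GtSupLetterG (F.cover jc) n K (fun m bt => w m (projBond (F.P K) jc 0 bt)) Gc CG) :
    ∃ (w' : BondIdx D → ℝ) (hw' : ∀ i, 0 < w' i) (G : (PBond (F.P K) 0 → ℝ) →ₗ[ℝ] (PBond (F.P K) 0 → ℝ)),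
      IsFlatGW F n K D hw' G ∧ GtSupLetterG F n K w G CG ∧ ∀ c : BondIdx D, w' c ≤ ((F.L : ℝ) ^ (K - n)) ^ 2 * (F.L : ℝ) ^ (c.1.1 : ℕ) := by
  obtain ⟨hwt, Gc, hGc, hGcs⟩ := hup
  have hL0 : (0 : ℝ) < (F.L : ℝ) := Nat.cast_pos.2 (by have := F.hL.2; omega)
  have hws : ∀ i : BondIdx D, 0 < ((F.L : ℝ) ^ (K - n) / (F.L : ℝ) ^ (i.1.1 : ℕ)) ^ 2 * ((F.L : ℝ) ^ (i.1.1 : ℕ)) ^ (2 + 1) := fun i => by positivity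
  obtain ⟨G, hG⟩ := exists_isFlatGW F n K D hws
  refine ⟨_, hws, G, hG, gtSupLetterG_of_cover F n K jc (fun f bt => isFlatGW_cover F n K jc D hws hG hGc f bt) hGcs, fun c => le_of_eq ?_⟩
  have hb : ((F.L : ℝ) ^ (c.1.1 : ℕ)) ≠ 0 := pow_ne_zero _ hL0.ne'
  field_simp

/-- ★ **(P-3) DESCENDS WITH THE SAME `C_X` — THE (X1) SUP ROW `w₃(b)·|(∂^{η*}∂^η flatH X)(b)| ≤ C_X·t`**: read the cover's row at the periodic datum `X ∘ projIdx` and a lift of `b`;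
★★★`flatH_cover` + ✓`dcsE_dcE_cover` identify the stencil value. [cite: Balaban1984PropagatorsII, Prop. 2.7 (2.149) p.249, (2.19) p.226; Balaban1985Variational, (45)-(46) p.285] -/
theorem curlCurlSup_of_cover {w : ℕ → PBond (F.P K) 0 → ℝ} {CX : ℝ}
    (hup : ∀ (Xt : BondIdx (D.comap jc) → ℝ) (t : ℝ), 0 ≤ t → (∀ c, |Xt c| ≤ t) → ∀ bt : PBond ((F.cover jc).P K) 0,
      w 3 (projBond (F.P K) jc 0 bt) * |(dcsE ((F.L : ℝ) ^ (K - n)) (dcE ((F.L : ℝ) ^ (K - n))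
        (WithLp.toLp 2 (flatH (F.cover jc) n K (D.comap jc) Xt)))) bt| ≤ CX * t) :
    ∀ (X : BondIdx D → ℝ) (t : ℝ), 0 ≤ t → (∀ c, |X c| ≤ t) → ∀ b : PBond (F.P K) 0,
      w 3 b * |(dcsE ((F.L : ℝ) ^ (K - n)) (dcE ((F.L : ℝ) ^ (K - n)) (WithLp.toLp 2 (flatH F n K D X)))) b| ≤ CX * t := by
  intro X t ht hX b
  -- read the goal at the lift `b̃₀` of `b` and identify the stencil value upstairs
  rw [← projBond_liftBond jc b, ← dcsE_dcE_cover F n K jc (flatH F n K D X) (flatH (F.cover jc) n K (D.comap jc) (X ∘ projIdx D jc))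
    (fun bt' => flatH_cover F n K jc D X bt') (liftBond jc b)]
  exact hup (X ∘ projIdx D jc) t ht (fun c => hX _) (liftBond jc b)

/-- ★ **(P-3♯) DESCENDS WITH THE SAME `C♯`** — the (X1) sup row at LEVEL-weighted data `(L^{j(c)}η)|X c| ≤ t` (`projIdx` keeps the level, the cover has the same `L`).
[cite: Balaban1984PropagatorsII, Prop. 2.7 (2.149) p.249, (2.19) p.226; Balaban1985Variational, (45)-(46) p.285] -/
theorem curlCurlSupSharp_of_cover {w : ℕ → PBond (F.P K) 0 → ℝ} {CX : ℝ}
    (hup : ∀ (Xt : BondIdx (D.comap jc) → ℝ) (t : ℝ), 0 ≤ t →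
      (∀ c, (F.L : ℝ) ^ ((c.1.1 : ℕ)) * ((F.L : ℝ)⁻¹) ^ (K - n) * |Xt c| ≤ t) → ∀ bt : PBond ((F.cover jc).P K) 0,
      w 3 (projBond (F.P K) jc 0 bt) * |(dcsE ((F.L : ℝ) ^ (K - n)) (dcE ((F.L : ℝ) ^ (K - n))
        (WithLp.toLp 2 (flatH (F.cover jc) n K (D.comap jc) Xt)))) bt| ≤ CX * t) :
    ∀ (X : BondIdx D → ℝ) (t : ℝ), 0 ≤ t → (∀ c, (F.L : ℝ) ^ ((c.1.1 : ℕ)) * ((F.L : ℝ)⁻¹) ^ (K - n) * |X c| ≤ t) → ∀ b : PBond (F.P K) 0,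
      w 3 b * |(dcsE ((F.L : ℝ) ^ (K - n)) (dcE ((F.L : ℝ) ^ (K - n)) (WithLp.toLp 2 (flatH F n K D X)))) b| ≤ CX * t := by
  intro X t ht hX b
  rw [← projBond_liftBond jc b, ← dcsE_dcE_cover F n K jc (flatH F n K D X) (flatH (F.cover jc) n K (D.comap jc) (X ∘ projIdx D jc))
    (fun bt' => flatH_cover F n K jc D X bt') (liftBond jc b)]
  exact hup (X ∘ projIdx D jc) t ht (fun c => hX (projIdx D jc c)) (liftBond jc b)

end Generic

/-! ## §2 Size bookkeeping of the lift; the `G`-band port with the weights displayed -/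

/-- **THE SIZE BOOKKEEPING OF THE LIFT** (pure arithmetic + (2.1)–(2.2)): with `jc := M_h⁰ + 2` and `a″ := min a′ M_h⁰`, `M_h″ := L^{a″} ≥ M_h⁰`, the upstairs size
condition `a″ + 3 ≤ (m + jc) + n` holds, and `Adm22 D R (L·M_h)` descends to block size `L·M_h″ ∣ L·M_h` and lifts to the cover.
[cite: Balaban1984PropagatorsII, (2.1)-(2.3) p.224] -/
theorem liftData (ℓ : ℕ) (hL : Odd (ℓ + 1) ∧ 1 < ℓ + 1) (Mh₀ : ℕ) {m n K Mh R a' : ℕ} (hm : 1 ≤ m) (hMha : Mh = (ℓ + 1) ^ a') (hMh : Mh₀ ≤ Mh)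
    (D : Domains (PV 2 ℓ m K hd3 hL)) (hAdm : Adm22 D R ((ℓ + 1) * Mh)) :
    ∃ a'' : ℕ, Mh₀ ≤ (ℓ + 1) ^ a'' ∧ a'' + 3 ≤ m + (Mh₀ + 2) + n ∧ Adm22 (D.comap (Mh₀ + 2)) R ((ℓ + 1) * (ℓ + 1) ^ a'') := by
  refine ⟨min a' Mh₀, ?_, by have := Nat.min_le_right a' Mh₀; omega, ?_⟩
  · rcases le_total a' Mh₀ with h | h
    · rw [min_eq_left h, ← hMha]; exact hMh
    · rw [min_eq_right h]; exact (Nat.lt_pow_self hL.2).le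
  · have hdvd : (ℓ + 1) * (ℓ + 1) ^ min a' Mh₀ ∣ (ℓ + 1) * Mh := by
      rw [hMha]; exact Nat.mul_dvd_mul_left _ (pow_dvd_pow _ (Nat.min_le_left _ _))
    exact adm22_comap D (Mh₀ + 2) ⟨min a' Mh₀ + 1, by rw [pow_succ']⟩ (adm22_of_dvd hAdm hdvd)

section Carrier

variable (ℓ : ℕ) (hL : Odd (ℓ + 1) ∧ 1 < ℓ + 1) (m : ℕ) (hm : 1 ≤ m) (n K : ℕ)
variable {Mh R : ℕ} {P' : Fin (2 + 1) → ℕ}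
variable (hN : ∀ μ, N0 ℓ Mh (K - n) P' μ = (PV 2 ℓ m K hd3 hL).sitesPerDir 0) (D : TDomains 2 ℓ Mh (K - n) P' R) (hk : K - n ≤ m + K)

/-- **✓`FlatPortGBandL0.gBand_domT` WITH THE WEIGHTS DISPLAYED** — the unit-band weights `w♯(c) = (L^{K−n}/L^{j(c)})²(L^{j(c)})³` in the statement instead of behind `∃ w′`
(the same proof: (2.136) at `b₀ = b₁ = 1`, Lemma 2.1 on the torus, `gRows_of_portShapes`). [cite: Balaban1984PropagatorsII, (2.16) p.225, Prop. 2.6 (2.136) p.247, Lemma 2.1 (2.60)-(2.61) p.234] -/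
theorem gBandU_domT (ℓ : ℕ) (hL : Odd (ℓ + 1) ∧ 1 < ℓ + 1) (hℓ : 4 ≤ ℓ) :
    ∃ (Mh₀ R₀ : ℕ) (CG : ℝ), 0 ≤ CG ∧
    ∀ (m : ℕ) (hm : 1 ≤ m) (n K : ℕ) {Mh R : ℕ} {P' : Fin (2 + 1) → ℕ} (hN : ∀ μ, N0 ℓ Mh (K - n) P' μ = (PV 2 ℓ m K hd3 hL).sitesPerDir 0)
      (D : TDomains 2 ℓ Mh (K - n) P' R) (hk : K - n ≤ m + K) (_ : 1 ≤ K - n)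
      {P'' : Fin (2 + 1) → ℕ} (_ : ∀ μ, P' μ = (ℓ + 1) * P'' μ) (_ : ∀ μ, 5 ≤ P'' μ)
      {a : ℕ} (_ : Mh = (ℓ + 1) ^ a) (_ : Mh₀ ≤ Mh) (_ : R₀ ≤ R)
      (w : ℕ → PBond (PV 2 ℓ m K hd3 hL) 0 → ℝ) (_ : IsLevWeight (⟨ℓ + 1, hL, m, hm⟩ : T3Family) n K (B6GlobalChartV1L0.domT hN D hk) w),
      ∃ (hw' : ∀ i : BondIdx (domT hN D hk), 0 < ((((ℓ + 1 : ℕ) : ℝ)) ^ (K - n) / (((ℓ + 1 : ℕ) : ℝ)) ^ (i.1.1 : ℕ)) ^ 2 * ((((ℓ + 1 : ℕ) : ℝ)) ^ (i.1.1 : ℕ)) ^ (2 + 1))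
        (G : (PBond (PV 2 ℓ m K hd3 hL) 0 → ℝ) →ₗ[ℝ] (PBond (PV 2 ℓ m K hd3 hL) 0 → ℝ)),
        IsFlatGW (⟨ℓ + 1, hL, m, hm⟩ : T3Family) n K (domT hN D hk) hw' G ∧ GtSupLetterG (⟨ℓ + 1, hL, m, hm⟩ : T3Family) n K w G CG := by
  -- the (2.136) package at the unit band `b₀ = b₁ = 1`
  obtain ⟨σc, hσc, hC⟩ := prop26_2136_lap_kLevel_unconditional_pad_V1 2 ℓ hd3 hL one_pos (le_refl (1 : ℝ))
  obtain ⟨A, M₂c, hA0, hM₂c, hrowsC⟩ := hC σc hσc le_rfl (1 / 2) (by norm_num) (by norm_num)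
  -- the rate
  set δ₃ : ℝ := delta3 (1 / 2) (2 * σc) with hδ₃
  have hδ₃0 : 0 < δ₃ := delta3_pos (by norm_num) (by linarith)
  -- Lemma-2.1 budget at rate `δ₃/2` and the absorption threshold
  obtain ⟨hNgpos, hθg⟩ := theta_budget ℓ (show 0 < 1 / 2 * δ₃ by positivity)
  set Ng : ℕ := ⌈2 * ((2 + 1 : ℕ) : ℝ) * Real.log ((ℓ : ℝ) + 1) / (1 / 2 * δ₃)⌉₊ + 1 with hNg
  set Nag : ℕ := ⌈2 * ((2 : ℝ) + 3) * ((ℓ : ℝ) + 1) / δ₃⌉₊ with hNag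
  set Lr : ℝ := (ℓ : ℝ) + 1 with hLr
  have hL1 : (1 : ℝ) ≤ Lr := by rw [hLr]; linarith [(Nat.cast_nonneg ℓ : (0 : ℝ) ≤ ℓ)]
  set c1g : ℝ := K261 Ng (2 + 1) Lr 1 (1 / 2 * δ₃) with hc1g
  have hc1g0 : 0 ≤ c1g := K261_nonneg (by linarith : (0 : ℝ) ≤ Lr) zero_le_one
  -- thresholds
  set Mh₀ : ℕ := max 8 ⌈M₂c⌉₊ with hMh₀
  set R₀ : ℕ := max (2 * (ℓ + 1) ^ 2) (max (Ng + 1) (Nag + 1)) with hR₀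
  refine ⟨Mh₀, R₀, A * Lr ^ 3 * c1g, by positivity, ?_⟩
  intro m hm n K Mh R P' hN D hk hk1 P'' hLP hP5 a hMha hMh hR w hw
  have hM8 : 8 ≤ Mh := le_trans (le_max_left _ _) hMh
  have hMh1 : 1 ≤ Mh := le_trans (by norm_num) hM8
  have hR2 : 2 * (ℓ + 1) ^ 2 ≤ R := le_trans (le_max_left _ _) hR
  have hRLM : ∀ {N : ℕ}, N + 1 ≤ R₀ → N + 1 ≤ R * ((ℓ + 1) * Mh) := fun {N} h =>
    le_trans (le_trans h hR) (Nat.le_mul_of_pos_right R (Nat.mul_pos (Nat.succ_pos ℓ) (by omega)))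
  have hNg' : Ng + 1 ≤ R * ((ℓ + 1) * Mh) := hRLM (le_trans (le_max_left _ _) (le_max_right _ _))
  have hNag' : Nag + 1 ≤ R * ((ℓ + 1) * Mh) := hRLM (le_trans (le_max_right _ _) (le_max_right _ _))
  have hRM1 : 1 ≤ R * ((ℓ + 1) * Mh) := le_trans (by omega) hNg'
  have hM₂c' : M₂c ≤ ((ℓ : ℝ) + 1) * Mh := by
    have h1 : M₂c ≤ (⌈M₂c⌉₊ : ℝ) := Nat.le_ceil _
    have h2 : (⌈M₂c⌉₊ : ℝ) ≤ (Mh : ℝ) := by exact_mod_cast le_trans (le_max_right _ _) hMh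
    have h3 : (Mh : ℝ) ≤ ((ℓ : ℝ) + 1) * Mh := le_mul_of_one_le_left (Nat.cast_nonneg _) hL1
    linarith
  have hP1 : ∀ μ, 1 ≤ P' μ := fun μ => by rw [hLP μ]; exact Nat.mul_pos (Nat.succ_pos ℓ) (by have := hP5 μ; omega)
  have hP5L : ∀ μ, 5 * (ℓ + 1) ≤ P' μ := fun μ => by rw [hLP μ, mul_comm]; exact Nat.mul_le_mul_left _ (hP5 μ)
  -- the band weights
  set ws : BondIdx (domT hN D hk) → ℝ := fun i =>
    ((((ℓ + 1 : ℕ) : ℝ)) ^ (K - n) / (((ℓ + 1 : ℕ) : ℝ)) ^ (i.1.1 : ℕ)) ^ 2 * ((((ℓ + 1 : ℕ) : ℝ)) ^ (i.1.1 : ℕ)) ^ (2 + 1) with hws_def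
  have hws : ∀ i, 0 < ws i := unitWeights_pos ℓ hL m n K hN D hk
  have hband : GlobalBand (Dm := domT hN D hk) 1 1 ((((ℓ + 1 : ℕ) : ℝ)) ^ (K - n)) ws := globalBand_unitWeights ℓ hL m n K hN D hk
  -- the (2.136) majorants at these data
  obtain ⟨hGm, hDGm, hLapm⟩ := hrowsC m K hN D hk hk1 hMha hM8 hR2 hP5L hℓ hM₂c' (cf_ne_zero ℓ n K) hws hband
  -- Lemma 2.1 on the torus at rate `δ₃` and the absorption threshold
  obtain ⟨-, h261g, -, -⟩ := lemma21_torus (D := D) hMh1 hP1 hNgpos hNg' hδ₃0.le (by norm_num : (0 : ℝ) ≤ 1 / 2) (by norm_num : (1 : ℝ) / 2 ≤ 1) hθg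
  obtain ⟨-, hsmg, -⟩ := absorb_budget ℓ hδ₃0 hNag'
  obtain ⟨hflat, hsup, -⟩ := gRows_of_portShapes ℓ hL m hm n K hN D hk hMh1 hP1 hRM1 hws hA0 hδ₃0.le hGm hDGm hLapm hsmg h261g w hw
  exact ⟨hws, _, hflat, hsup⟩

end Carrier

/-- **✓`FlatPortGBandL0.gBand_of_adm22` WITH THE WEIGHTS DISPLAYED** (every `Adm22` family; via ✓`FlatPortChartL0.tdOfAdmL0`∕`domT_tdOfAdmL0`).
[cite: Balaban1984PropagatorsII, (2.1)-(2.2) p.224, (2.16) p.225, Prop. 2.6 (2.136) p.247; Balaban1985Variational, (165) p.304] -/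
theorem gBandU_of_adm22 (ℓ : ℕ) (hL : Odd (ℓ + 1) ∧ 1 < ℓ + 1) (hℓ : 4 ≤ ℓ) :
    ∃ (Mh₀ R₀ : ℕ) (CG : ℝ), 0 ≤ CG ∧
    ∀ (m : ℕ) (hm : 1 ≤ m) (n K : ℕ) (_ : 1 ≤ K - n) (_ : K - n + 1 ≤ m + K) {Mh R a' : ℕ} (_ : Mh = (ℓ + 1) ^ a') (_ : Mh₀ ≤ Mh) (_ : R₀ ≤ R) (_ : a' + 3 ≤ m + n)
      (D : Domains (PV 2 ℓ m K hd3 hL)) (_ : D.k = K - n) (_ : Adm22 D R ((ℓ + 1) * Mh))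
      (w : ℕ → PBond (PV 2 ℓ m K hd3 hL) 0 → ℝ) (_ : IsLevWeight (⟨ℓ + 1, hL, m, hm⟩ : T3Family) n K D w),
      ∃ (hw' : ∀ i : BondIdx D, 0 < ((((ℓ + 1 : ℕ) : ℝ)) ^ (K - n) / (((ℓ + 1 : ℕ) : ℝ)) ^ (i.1.1 : ℕ)) ^ 2 * ((((ℓ + 1 : ℕ) : ℝ)) ^ (i.1.1 : ℕ)) ^ (2 + 1))
        (G : (PBond (PV 2 ℓ m K hd3 hL) 0 → ℝ) →ₗ[ℝ] (PBond (PV 2 ℓ m K hd3 hL) 0 → ℝ)),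
        IsFlatGW (⟨ℓ + 1, hL, m, hm⟩ : T3Family) n K D hw' G ∧ GtSupLetterG (⟨ℓ + 1, hL, m, hm⟩ : T3Family) n K w G CG := by
  obtain ⟨Mh₀, R₀, CG, hCG, hmain⟩ := gBandU_domT ℓ hL hℓ
  refine ⟨Mh₀, R₀, CG, hCG, ?_⟩
  intro m hm n K hk1 hk' Mh R a' hMha hMh hR hsize D hDk hAdm w hw
  have hk : K - n ≤ m + K := by omega
  obtain ⟨hN, hLP, hP5⟩ := chart_params ℓ m n K a' hL hℓ hk1 hsize
  have hN' : ∀ μ : Fin (2 + 1), N0 ℓ Mh (K - n) (fun _ => 2 * (ℓ + 1) ^ (m + n - 1 - a')) μ = (PV 2 ℓ m K hd3 hL).sitesPerDir 0 := by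
    rw [hMha]; exact hN
  set D' := FlatPortChartL0.tdOfAdmL0 hN' D hDk hk hAdm with hD'
  have hEq : domT hN' D' hk = D := FlatPortChartL0.domT_tdOfAdmL0 hN' D hDk hk hAdm
  rw [← hEq] at hw ⊢
  exact hmain m hm n K hN' D' hk hk1 hLP hP5 hMha hMh hR w hw

/-! ## §3 ★ The ports at every torus size -/

/-- ★ **(P-1) AT EVERY TORUS SIZE — THE BODY OF THE REGISTERED P2 TEXT AT EVERY ADMISSIBLE DATUM, NO `a′ + 3 ≤ m + n`**: ✓`FlatPortBodyL0.body_of_adm22` verbatim with that binder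
deleted (constant `max B₀ 0 · (L^{M_h⁰+2})³`); small members are read on their cover (`liftData` + the L0 port upstairs + `body_of_cover`).
[cite: Balaban1985Variational, (46) p.285, (144) p.300, (157)-(158) p.302, (161)-(163) p.303, (165) p.304; Balaban1984PropagatorsII, (2.1)-(2.3) p.224, Prop. 2.6 (2.136) p.247, Cor. 2.8 p.249] -/
theorem body_of_adm22_allSizes (ℓ : ℕ) (hL : Odd (ℓ + 1) ∧ 1 < ℓ + 1) (hℓ : 4 ≤ ℓ) :
    ∃ (Mh₀ R₀ : ℕ) (B₀ δ₀ B₃ : ℝ), 0 < δ₀ ∧ 0 < B₃ ∧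
    ∀ (m : ℕ) (hm : 1 ≤ m) (n K : ℕ) (_ : 1 ≤ K - n) (_ : K - n + 1 ≤ m + K) {Mh R a' : ℕ} (_ : Mh = (ℓ + 1) ^ a') (_ : Mh₀ ≤ Mh) (_ : R₀ ≤ R)
      (D : Domains (PV 2 ℓ m K hd3 hL)) (_ : D.k = K - n) (_ : Adm22 D R ((ℓ + 1) * Mh))
      (w : ℕ → PBond (PV 2 ℓ m K hd3 hL) 0 → ℝ) (_ : IsLevWeight (⟨ℓ + 1, hL, m, hm⟩ : T3Family) n K D w),
      ∃ (H : (BondIdx D → ℝ) →ₗ[ℝ] (PBond (PV 2 ℓ m K hd3 hL) 0 → ℝ)) (Gt : (PBond (PV 2 ℓ m K hd3 hL) 0 → ℝ) →ₗ[ℝ] (PBond (PV 2 ℓ m K hd3 hL) 0 → ℝ)),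
        IsFlatH (⟨ℓ + 1, hL, m, hm⟩ : T3Family) n K D H ∧ IsFlatGt (⟨ℓ + 1, hL, m, hm⟩ : T3Family) n K D Gt ∧
        HSupLetterG (⟨ℓ + 1, hL, m, hm⟩ : T3Family) n K D w H B₀ ∧ GtSupLetterG (⟨ℓ + 1, hL, m, hm⟩ : T3Family) n K w Gt B₀ ∧
          GtLaplaceLetterG (⟨ℓ + 1, hL, m, hm⟩ : T3Family) n K w Gt B₀ ∧
        ∃ dBI : PBond (PV 2 ℓ m K hd3 hL) 0 → BondIdx D → ℝ,
          (∀ b c, distBI D b c ≤ dBI b c) ∧ RowSum162 (⟨ℓ + 1, hL, m, hm⟩ : T3Family) n K D dBI w δ₀ B₃ ∧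
            HDecayLetterD (⟨ℓ + 1, hL, m, hm⟩ : T3Family) n K D dBI w H B₀ δ₀ := by
  obtain ⟨Mh₀, R₀, B₀, δ₀, B₃, hδ₀, hB₃, hmain⟩ := body_of_adm22 ℓ hL hℓ
  refine ⟨Mh₀, R₀, max B₀ 0 * ((((ℓ + 1) ^ (Mh₀ + 2)) ^ 3 : ℕ) : ℝ), δ₀, B₃, hδ₀, hB₃, ?_⟩
  intro m hm n K hk1 hk' Mh R a' hMha hMh hR D hDk hAdm w hw
  obtain ⟨a'', hMh'', hsize'', hAdm''⟩ := liftData ℓ hL Mh₀ (n := n) hm hMha hMh D hAdm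
  obtain ⟨Ht, Gtt, hFHt, hFGt, h1, h2, h3, dBIt, hdom, h4, h5⟩ :=
    hmain (m + (Mh₀ + 2)) (by omega) n K hk1 (by omega) rfl hMh'' hR hsize'' (D.comap (Mh₀ + 2)) hDk hAdm''
      (fun k bt => w k (projBond (PV 2 ℓ m K hd3 hL) (Mh₀ + 2) 0 bt)) (isLevWeight_comap (⟨ℓ + 1, hL, m, hm⟩ : T3Family) n K (Mh₀ + 2) D hw)
  exact body_of_cover (⟨ℓ + 1, hL, m, hm⟩ : T3Family) n K (Mh₀ + 2) D hw (le_max_right B₀ 0) hδ₀.le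
    ⟨Ht, Gtt, hFHt, hFGt, hSupLetterG_mono h1 (le_max_left _ _), gtSupLetterG_mono h2 (le_max_left _ _), gtLaplaceLetterG_mono h3 (le_max_left _ _),
      dBIt, hdom, h4, hDecayLetterD_mono h5 (le_max_left _ _)⟩

/-- ★ **(P-1′) AT EVERY TORUS SIZE — THE (46) SUP ROW OF THE CANONICAL `flatH`, SAME CONSTANT `max C (C·B₃)`**: exactly the `.1.1` entry of ✓`FlatPortBodyL0.rowsAt_of_adm22` that
`…HalvingDressingLetterFlat`∕`…FlatScaled`∕`…ChartOfRecord` read, with the binder `a′ + 3 ≤ m + n` deleted (★★★`flatH_cover`).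
[cite: Balaban1985Variational, (46) p.285, (144) p.300, (157) p.302; Balaban1984PropagatorsII, (2.1)-(2.3) p.224, Cor. 2.8 (2.150)-(2.151) p.249] -/
theorem hSupFlatH_of_adm22_allSizes (ℓ : ℕ) (hL : Odd (ℓ + 1) ∧ 1 < ℓ + 1) (hℓ : 4 ≤ ℓ) :
    ∃ (Mh₀ R₀ : ℕ) (C : ℝ), 0 ≤ C ∧
    ∀ (m : ℕ) (hm : 1 ≤ m) (n K : ℕ) (_ : 1 ≤ K - n) (_ : K - n + 1 ≤ m + K) {Mh R a' : ℕ} (_ : Mh = (ℓ + 1) ^ a') (_ : Mh₀ ≤ Mh) (_ : R₀ ≤ R)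
      (D : Domains (PV 2 ℓ m K hd3 hL)) (_ : D.k = K - n) (_ : Adm22 D R ((ℓ + 1) * Mh))
      (w : ℕ → PBond (PV 2 ℓ m K hd3 hL) 0 → ℝ) (_ : IsLevWeight (⟨ℓ + 1, hL, m, hm⟩ : T3Family) n K D w),
      HSupLetterG (⟨ℓ + 1, hL, m, hm⟩ : T3Family) n K D w (flatH (⟨ℓ + 1, hL, m, hm⟩ : T3Family) n K D) C := by
  obtain ⟨Mh₀, R₀, C, δ₀, B₃, CG, hC, -, -, -, hmain⟩ := rowsAt_of_adm22 ℓ hL hℓ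
  refine ⟨Mh₀, R₀, max C (C * B₃), le_max_of_le_left hC, ?_⟩
  intro m hm n K hk1 hk' Mh R a' hMha hMh hR D hDk hAdm w hw
  obtain ⟨a'', hMh'', hsize'', hAdm''⟩ := liftData ℓ hL Mh₀ (n := n) hm hMha hMh D hAdm
  have hup := hmain (m + (Mh₀ + 2)) (by omega) n K hk1 (by omega) rfl hMh'' hR hsize'' (D.comap (Mh₀ + 2)) hDk hAdm''
    (fun k bt => w k (projBond (PV 2 ℓ m K hd3 hL) (Mh₀ + 2) 0 bt)) (isLevWeight_comap (⟨ℓ + 1, hL, m, hm⟩ : T3Family) n K (Mh₀ + 2) D hw)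
  exact hSupFlatH_of_cover (⟨ℓ + 1, hL, m, hm⟩ : T3Family) n K (Mh₀ + 2) D hup.1.1

/-- ★ **(P-2) AT EVERY TORUS SIZE — THE `G`-BAND PACKAGE, SAME `C_G`, NO `a′ + 3 ≤ m + n`**: ✓`FlatPortGBandL0.gBand_of_adm22` verbatim with that binder deleted (`gBandU_of_adm22`
upstairs + `gBand_of_cover`). [cite: Balaban1984PropagatorsII, (2.1)-(2.3) p.224, (2.16) p.225, Prop. 2.6 (2.136) p.247; Balaban1985Variational, (144) p.300, (165) p.304] -/
theorem gBand_of_adm22_allSizes (ℓ : ℕ) (hL : Odd (ℓ + 1) ∧ 1 < ℓ + 1) (hℓ : 4 ≤ ℓ) :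
    ∃ (Mh₀ R₀ : ℕ) (CG : ℝ), 0 ≤ CG ∧
    ∀ (m : ℕ) (hm : 1 ≤ m) (n K : ℕ) (_ : 1 ≤ K - n) (_ : K - n + 1 ≤ m + K) {Mh R a' : ℕ} (_ : Mh = (ℓ + 1) ^ a') (_ : Mh₀ ≤ Mh) (_ : R₀ ≤ R)
      (D : Domains (PV 2 ℓ m K hd3 hL)) (_ : D.k = K - n) (_ : Adm22 D R ((ℓ + 1) * Mh))
      (w : ℕ → PBond (PV 2 ℓ m K hd3 hL) 0 → ℝ) (_ : IsLevWeight (⟨ℓ + 1, hL, m, hm⟩ : T3Family) n K D w),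
      ∃ (w' : BondIdx D → ℝ) (hw' : ∀ i, 0 < w' i)
        (G : (PBond (PV 2 ℓ m K hd3 hL) 0 → ℝ) →ₗ[ℝ] (PBond (PV 2 ℓ m K hd3 hL) 0 → ℝ)),
        IsFlatGW (⟨ℓ + 1, hL, m, hm⟩ : T3Family) n K D hw' G ∧ GtSupLetterG (⟨ℓ + 1, hL, m, hm⟩ : T3Family) n K w G CG ∧
        ∀ c : BondIdx D, w' c ≤ ((((ℓ + 1 : ℕ) : ℝ)) ^ (K - n)) ^ 2 * (((ℓ + 1 : ℕ) : ℝ)) ^ (c.1.1 : ℕ) := by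
  obtain ⟨Mh₀, R₀, CG, hCG, hmain⟩ := gBandU_of_adm22 ℓ hL hℓ
  refine ⟨Mh₀, R₀, CG, hCG, ?_⟩
  intro m hm n K hk1 hk' Mh R a' hMha hMh hR D hDk hAdm w hw
  obtain ⟨a'', hMh'', hsize'', hAdm''⟩ := liftData ℓ hL Mh₀ (n := n) hm hMha hMh D hAdm
  obtain ⟨hwt, Gc, hGc, hGcs⟩ := hmain (m + (Mh₀ + 2)) (by omega) n K hk1 (by omega) rfl hMh'' hR hsize'' (D.comap (Mh₀ + 2)) hDk hAdm''
    (fun k bt => w k (projBond (PV 2 ℓ m K hd3 hL) (Mh₀ + 2) 0 bt)) (isLevWeight_comap (⟨ℓ + 1, hL, m, hm⟩ : T3Family) n K (Mh₀ + 2) D hw)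
  exact gBand_of_cover (⟨ℓ + 1, hL, m, hm⟩ : T3Family) n K (Mh₀ + 2) D ⟨hwt, Gc, hGc, hGcs⟩

/-- ★ **(P-3) AT EVERY TORUS SIZE — (X1), SAME `C_X`, NO `a′ + 3 ≤ m + n`**: ✓`FlatPortCurlCurlSupRowL0.curlCurlSupRow_of_adm22` verbatim with that binder deleted (the L0 port upstairs +
`curlCurlSup_of_cover`). [cite: Balaban1984PropagatorsII, (2.1)-(2.3) p.224, Prop. 2.7 (2.149) p.249; Balaban1985Variational, (45)-(46) p.285, (144) p.300] -/
theorem curlCurlSupRow_of_adm22_allSizes (ℓ : ℕ) (hL : Odd (ℓ + 1) ∧ 1 < ℓ + 1) (hℓ : 4 ≤ ℓ) :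
    ∃ (Mh₀ R₀ : ℕ) (CX : ℝ), 0 ≤ CX ∧
    ∀ (m : ℕ) (hm : 1 ≤ m) (n K : ℕ) (_ : 1 ≤ K - n) (_ : K - n + 1 ≤ m + K) {Mh R a' : ℕ} (_ : Mh = (ℓ + 1) ^ a') (_ : Mh₀ ≤ Mh) (_ : R₀ ≤ R)
      (D : Domains (PV 2 ℓ m K hd3 hL)) (_ : D.k = K - n) (_ : Adm22 D R ((ℓ + 1) * Mh))
      (w : ℕ → PBond (PV 2 ℓ m K hd3 hL) 0 → ℝ) (_ : IsLevWeight (⟨ℓ + 1, hL, m, hm⟩ : T3Family) n K D w),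
      ∀ (X : BondIdx D → ℝ) (t : ℝ), 0 ≤ t → (∀ c, |X c| ≤ t) → ∀ b : PBond (PV 2 ℓ m K hd3 hL) 0,
        w 3 b * |(dcsE ((((ℓ + 1 : ℕ) : ℝ)) ^ (K - n)) (dcE ((((ℓ + 1 : ℕ) : ℝ)) ^ (K - n))
          (WithLp.toLp 2 (flatH (⟨ℓ + 1, hL, m, hm⟩ : T3Family) n K D X)))) b| ≤ CX * t := by
  obtain ⟨Mh₀, R₀, CX, hCX, hmain⟩ := curlCurlSupRow_of_adm22 ℓ hL hℓ
  refine ⟨Mh₀, R₀, CX, hCX, ?_⟩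
  intro m hm n K hk1 hk' Mh R a' hMha hMh hR D hDk hAdm w hw
  obtain ⟨a'', hMh'', hsize'', hAdm''⟩ := liftData ℓ hL Mh₀ (n := n) hm hMha hMh D hAdm
  have hup := hmain (m + (Mh₀ + 2)) (by omega) n K hk1 (by omega) rfl hMh'' hR hsize'' (D.comap (Mh₀ + 2)) hDk hAdm''
    (fun k bt => w k (projBond (PV 2 ℓ m K hd3 hL) (Mh₀ + 2) 0 bt)) (isLevWeight_comap (⟨ℓ + 1, hL, m, hm⟩ : T3Family) n K (Mh₀ + 2) D hw)
  exact curlCurlSup_of_cover (⟨ℓ + 1, hL, m, hm⟩ : T3Family) n K (Mh₀ + 2) D hup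

/-- ★ **(P-3♯) AT EVERY TORUS SIZE — (X1♯) AT LEVEL-WEIGHTED DATA, SAME `C♯`, NO `a′ + 3 ≤ m + n`**: ✓`FlatPortCurlCurlSupRowSharpL0.curlCurlSupRowSharp_of_adm22` verbatim with that
binder deleted (the L0 port upstairs + `curlCurlSupSharp_of_cover`). [cite: Balaban1984PropagatorsII, (2.1)-(2.3) p.224, Prop. 2.7 (2.149) p.249; Balaban1985Variational, (45)-(46) p.285, (144) p.300] -/
theorem curlCurlSupRowSharp_of_adm22_allSizes (ℓ : ℕ) (hL : Odd (ℓ + 1) ∧ 1 < ℓ + 1) (hℓ : 4 ≤ ℓ) :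
    ∃ (Mh₀ R₀ : ℕ) (CX : ℝ), 0 ≤ CX ∧
    ∀ (m : ℕ) (hm : 1 ≤ m) (n K : ℕ) (_ : 1 ≤ K - n) (_ : K - n + 1 ≤ m + K) {Mh R a' : ℕ} (_ : Mh = (ℓ + 1) ^ a') (_ : Mh₀ ≤ Mh) (_ : R₀ ≤ R)
      (D : Domains (PV 2 ℓ m K hd3 hL)) (_ : D.k = K - n) (_ : Adm22 D R ((ℓ + 1) * Mh))
      (w : ℕ → PBond (PV 2 ℓ m K hd3 hL) 0 → ℝ) (_ : IsLevWeight (⟨ℓ + 1, hL, m, hm⟩ : T3Family) n K D w),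
      ∀ (X : BondIdx D → ℝ) (t : ℝ), 0 ≤ t → (∀ c, ((((ℓ + 1 : ℕ) : ℝ)) ^ ((c.1.1 : ℕ)) * ((((ℓ + 1 : ℕ) : ℝ))⁻¹) ^ (K - n)) * |X c| ≤ t) →
        ∀ b : PBond (PV 2 ℓ m K hd3 hL) 0,
          w 3 b * |(dcsE ((((ℓ + 1 : ℕ) : ℝ)) ^ (K - n)) (dcE ((((ℓ + 1 : ℕ) : ℝ)) ^ (K - n))
            (WithLp.toLp 2 (flatH (⟨ℓ + 1, hL, m, hm⟩ : T3Family) n K D X)))) b| ≤ CX * t := by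
  obtain ⟨Mh₀, R₀, CX, hCX, hmain⟩ := curlCurlSupRowSharp_of_adm22 ℓ hL hℓ
  refine ⟨Mh₀, R₀, CX, hCX, ?_⟩
  intro m hm n K hk1 hk' Mh R a' hMha hMh hR D hDk hAdm w hw
  obtain ⟨a'', hMh'', hsize'', hAdm''⟩ := liftData ℓ hL Mh₀ (n := n) hm hMha hMh D hAdm
  have hup := hmain (m + (Mh₀ + 2)) (by omega) n K hk1 (by omega) rfl hMh'' hR hsize'' (D.comap (Mh₀ + 2)) hDk hAdm''
    (fun k bt => w k (projBond (PV 2 ℓ m K hd3 hL) (Mh₀ + 2) 0 bt)) (isLevWeight_comap (⟨ℓ + 1, hL, m, hm⟩ : T3Family) n K (Mh₀ + 2) D hw)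
  exact curlCurlSupSharp_of_cover (⟨ℓ + 1, hL, m, hm⟩ : T3Family) n K (Mh₀ + 2) D hup

end Summit.QuantumFields.YangMills.Theorems.FlatPortAllSizes

end
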